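import Literature.NumberTheory.EllipticCurves.TateModuleTransvectionCriterionProofs
import Literature.NumberTheory.EllipticCurves.TateModuleBigImageOfSurjectiveProofs
import Literature.NumberTheory.EllipticCurves.FrobeniusTateModuleProofs
import Literature.NumberTheory.GaloisRepresentations.CyclotomicCharacterSurjectiveProofs
import HarnessLib

/-!
# Hypothesis (im) in DETERMINANT form: `det ρ_{E,p}(σ) = 1` replaces "`σ ∈ G_{ℚ(μ_{p^∞})}`"

Topic `NumberTheory/EllipticCurves`; theorems only (nothing is defined, no named fact).  Sequel of
`TateModuleTransvectionCriterionProofs` ((im) FAILS at an irreducible, non-surjective prime) and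
`TateModuleBigImageOfSurjectiveProofs` ((im) HOLDS at a surjective prime `p ≥ 5`), restating both in
the form in which the Kolyvagin-system / Iwasawa-main-conjecture literature quantifies the element:

> (im) there is `σ ∈ Γ_ℚ` with `det ρ_{E,p^∞}(σ) = 1` and `T_pE/(ρ(σ) - 1)T_pE ≃ ℤ_p`.

The two spellings agree because `det ρ_{E,p} = χ_p` on `T_pE` (Weil pairing; tree theorem
`WeierstrassCurve.det_galoisRepTate_eq_cyclotomicCharacter_holds`, Silverman *AEC* III.8) and
`χ_p(σ) = 1` iff `σ` fixes every `p`-power root of unity of `ℚ̄` (the defining property of the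
cyclotomic character, tree `GaloisRep.cyclotomicCharacter_spec` /
`cyclotomicCharacter_eq_one_of_forall_pow_eq_one`).  This is exactly the typed vocabulary
`KolyvaginTransvection W p` of the BSD cell `bsd-f3-mu` (IMC lens, exhibit `ImageEntryX9.lean`,
2026-08-28) for hypothesis (im) of Burungale–Castella–Skinner 2025, Thm. 1.1.2 (b) (= Kato 2004,
Thm. 13.4 (3); Mazur–Rubin 2004 §3.5; Skinner 2016 §2.5 (b)); the theorems below discharge, UNFOLDED
and without any new definition, that cell's candidate statements `B-imc-im`
("no Kolyvagin transvection at an irreducible non-surjective prime", in particular on class X9) and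
`SurjectiveIffTransvection` (at an irreducible prime `p ≥ 5`: `ρ̄_{E,p}` onto ⟺ (im)).

**Theorems** (`E = W/ℚ` an elliptic curve, `p` a prime, `T = T_pE = W.tateModule p`,
`ρ = W.galoisRepTate p`).

* `WeierstrassCurve.det_galoisRepTate_eq_one_iff_forall_smul_eq_self`:
  `det ρ(σ) = 1 ↔ ∀ n t, t ^ p ^ n = 1 → σ • t = t`.
* `WeierstrassCurve.not_exists_det_galoisRepTate_eq_one_quotient_equiv`: if `E[p]` is irreducible
  and `ρ̄_{E,p}` is not surjective, there is NO `σ` with `det ρ(σ) = 1` and `T/(ρ(σ) - 1)T ≃ ℤ_p`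
  (any prime `p`, any reduction type).
* `WeierstrassCurve.exists_det_galoisRepTate_eq_one_quotient_equiv_of_surjective`: if `p ≥ 5` and
  `ρ̄_{E,p}` is surjective, such a `σ` exists.
* `WeierstrassCurve.hasSurjectiveModNGaloisRep_iff_exists_det_galoisRepTate_eq_one_quotient_equiv`:
  for `p ≥ 5` and `E[p]` irreducible, `ρ̄_{E,p}` is surjective iff (im) holds in determinant form.

## References

* [BurungaleCastellaSkinner2025] A. Burungale, F. Castella, C. Skinner, IMRN 2025 (rnaf082) =
  arXiv:2405.00270v2, p. 2, hypothesis (im) of Thm. 1.1.2 (b); Rem. 1.1.3 (i), (iii).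
* [Kato2004Asterisque] K. Kato, Astérisque 295 (2004), Thm. 13.4 (3) (p. 226); (12.5.2) (p. 222).
* [MazurRubin2004] B. Mazur, K. Rubin, *Kolyvagin systems*, Mem. AMS 799 (2004), §3.5.
* [Serre1972] J.-P. Serre, Invent. Math. 15 (1972), §2.4 Prop. 15.
* [SerreAbelianLadic1968] J.-P. Serre, *Abelian ℓ-adic representations* (1968), Ch. I §1.2
  (cyclotomic character), Ch. IV §3.4 Lemma 3 (IV-23).
* [SilvermanAEC2009] J. H. Silverman, *AEC*, Prop. III.8.1, III.8.3 (`det = χ_p` via the Weil pairing).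
-/

noncomputable section

open scoped Classical
open Field

namespace WeierstrassCurve

open Literature.NumberTheory.EllipticCurves Literature.NumberTheory.GaloisRepresentations

variable (W : WeierstrassCurve ℚ) [W.IsElliptic] (p : ℕ) [Fact p.Prime]

/-- **`det ρ_{E,p}(σ) = 1` iff `σ` fixes every `p`-power root of unity of `ℚ̄`** (`det ρ = χ_p` by the
Weil pairing, and the defining property of the cyclotomic character).  This identifies the two
spellings "`σ ∈ G_{ℚ(μ_{p^∞})}`" and "`det ρ(σ) = 1`" of the element in hypothesis (im).
[cite: SilvermanAEC2009, Prop. III.8.1 and Prop. III.8.3] [cite: SerreAbelianLadic1968, Ch. I §1.2] -/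
theorem det_galoisRepTate_eq_one_iff_forall_smul_eq_self (σ : absoluteGaloisGroup ℚ) :
    LinearMap.det (W.galoisRepTate p σ : W.tateModule p →ₗ[ℤ_[p]] W.tateModule p) = 1 ↔
      ∀ (n : ℕ) (t : AlgebraicClosure ℚ), t ^ p ^ n = 1 → σ • t = t := by
  have hp : p.Prime := Fact.out
  have hp0 : (p : ℚ) ≠ 0 := Nat.cast_ne_zero.mpr hp.ne_zero
  rw [W.det_galoisRepTate_eq_cyclotomicCharacter_holds p hp0 σ, Units.val_eq_one]
  constructor
  · intro hσ n t ht
    exact GaloisRep.smul_eq_self_of_cyclotomicCharacter_eq_one ℚ p hσ n t ht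
  · intro hσ
    rw [GaloisRep.cyclotomicCharacter_apply]
    exact cyclotomicCharacter_eq_one_of_forall_pow_eq_one p _ fun n t ht => hσ n t ht

/-- **(im) in determinant form FAILS at an irreducible, non-surjective prime** (`B-imc-im` of the
BSD cell `bsd-f3-mu`, unfolded; any prime `p`, any reduction type): if `E[p]` is irreducible and
`ρ̄_{E,p}` is not surjective there is no `σ ∈ Γ_ℚ` with `det ρ_{E,p}(σ) = 1` and
`T_pE/(ρ(σ) - 1)T_pE ≃ ℤ_p`.  Such a `σ` fixes `μ_{p^∞}`
(`det_galoisRepTate_eq_one_iff_forall_smul_eq_self`), contradicting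
`not_exists_galoisRepTate_quotient_equiv` (reduction mod `p`: `σ̄` would be a transvection of order
`p` in `ρ̄(Γ_ℚ)`, so Serre's Prop. 15 would make the image Borel or all of `GL₂(𝔽_p)`).
[cite: BurungaleCastellaSkinner2025, hypothesis (im) and Rem. 1.1.3 (iii) (p. 2)]
[cite: Serre1972, §2.4 Prop. 15] -/
theorem not_exists_det_galoisRepTate_eq_one_quotient_equiv
    (hirr : W.HasIrreducibleModPGaloisRep p) (hns : ¬ W.HasSurjectiveModNGaloisRep p) :
    ¬ ∃ σ : absoluteGaloisGroup ℚ,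
      LinearMap.det (W.galoisRepTate p σ : W.tateModule p →ₗ[ℤ_[p]] W.tateModule p) = 1 ∧
        Nonempty (((W.tateModule p) ⧸ LinearMap.range
          ((W.galoisRepTate p σ : W.tateModule p →ₗ[ℤ_[p]] W.tateModule p) - 1)) ≃ₗ[ℤ_[p]] ℤ_[p]) := by
  rintro ⟨σ, hdet, hq⟩
  exact W.not_exists_galoisRepTate_quotient_equiv p hirr hns
    ⟨σ, (W.det_galoisRepTate_eq_one_iff_forall_smul_eq_self p σ).mp hdet, hq⟩

/-- **(im) in determinant form HOLDS at a surjective prime `p ≥ 5`**: if `ρ̄_{E,p}` is onto there is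
`σ ∈ Γ_ℚ` with `det ρ_{E,p}(σ) = 1` and `T_pE/(ρ(σ) - 1)T_pE ≃ ℤ_p` (Serre's lifting lemma puts
`(1 1; 0 1)` in the `p`-adic image; tree `exists_quotient_range_galoisRepTate_sub_one_equiv_of_surjective`).
[cite: SerreAbelianLadic1968, Ch. IV §3.4 Lemma 3 (IV-23)]
[cite: BurungaleCastellaSkinner2025, Rem. 1.1.3 (i) (p. 2)] -/
theorem exists_det_galoisRepTate_eq_one_quotient_equiv_of_surjective (h5 : 5 ≤ p)
    (hsurj : W.HasSurjectiveModNGaloisRep p) :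
    ∃ σ : absoluteGaloisGroup ℚ,
      LinearMap.det (W.galoisRepTate p σ : W.tateModule p →ₗ[ℤ_[p]] W.tateModule p) = 1 ∧
        Nonempty (((W.tateModule p) ⧸ LinearMap.range
          ((W.galoisRepTate p σ : W.tateModule p →ₗ[ℤ_[p]] W.tateModule p) - 1)) ≃ₗ[ℤ_[p]] ℤ_[p]) := by
  obtain ⟨σ, hσ, hq⟩ := W.exists_quotient_range_galoisRepTate_sub_one_equiv_of_surjective p h5 hsurj
  exact ⟨σ, (W.det_galoisRepTate_eq_one_iff_forall_smul_eq_self p σ).mpr hσ, hq⟩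

/-- **At an irreducible prime `p ≥ 5`: `ρ̄_{E,p}` surjective ⟺ (im) in determinant form**
(`SurjectiveIffTransvection` of the BSD cell `bsd-f3-mu`, unfolded, with only the hypotheses that are
used: `p ≥ 5` for `⟹`, irreducibility for `⟸`).  So among irreducible primes `p ≥ 5` the locus where
no printed weakening of Kato's image hypothesis applies is exactly the non-surjective one (class X9 of
the BSD rank-≤1 residual census).
[cite: BurungaleCastellaSkinner2025, Thm. 1.1.2 (b) and Rem. 1.1.3 (i), (iii) (p. 2)]
[cite: Serre1972, §2.4 Prop. 15] -/
theorem hasSurjectiveModNGaloisRep_iff_exists_det_galoisRepTate_eq_one_quotient_equiv (h5 : 5 ≤ p)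
    (hirr : W.HasIrreducibleModPGaloisRep p) :
    W.HasSurjectiveModNGaloisRep p ↔
      ∃ σ : absoluteGaloisGroup ℚ,
        LinearMap.det (W.galoisRepTate p σ : W.tateModule p →ₗ[ℤ_[p]] W.tateModule p) = 1 ∧
          Nonempty (((W.tateModule p) ⧸ LinearMap.range
            ((W.galoisRepTate p σ : W.tateModule p →ₗ[ℤ_[p]] W.tateModule p) - 1)) ≃ₗ[ℤ_[p]] ℤ_[p]) := by
  constructor
  · exact W.exists_det_galoisRepTate_eq_one_quotient_equiv_of_surjective p h5
  · intro h
    by_contra hns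
    exact W.not_exists_det_galoisRepTate_eq_one_quotient_equiv p hirr hns h

end WeierstrassCurve

end
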